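import Mathlib
import HarnessLib
import Summits.ResolutionOfSingularities.ResolutionOfSingularities.Theorems.WildQuotientsWildQuotientResolutionS1aLaurentGrading
import Summits.ResolutionOfSingularities.ResolutionOfSingularities.Theorems.WildQuotientsWildQuotientResolutionS1aNodeReindex
import Summits.ResolutionOfSingularities.ResolutionOfSingularities.Theorems.FrobeniusLadderFRationalResolutionToricDegenerateRegular
import Literature.AlgebraicGeometry.Resolution.KiralyLutkebohmert

/-!
# S1a — (M) MULT-GOOD: the LAURENT NODE `B[x, x⁻¹]`, `σ″ x = x u`, of a tame node with a unit-row semi-invariant is a KILLED tame node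

[OURS · L1 W4.5c · lead-1 g11; plan-1 SIG (M) v2 `Cruxes/CyclicQuotientFourfolds/Lines/W45cMultGoodSig.lean` (646be4e56a48), A-NIL v0 §3 (torsor trick),
A-KF v0 (O4) «refinement is necessary: the Laurent chart at a multiplicative point»; ASSIGNMENT v10.34 «(M) refinement tool»] — NOT statements of the
manuscript; counted 0; AI-level work, weaker than expert review. Crux stmt-ResolutionOfSingularities-17941 `CyclicQuotientFourfolds`, line
`s1a-logminvertex` v12 (`stub_reachLowerInF`): PRODUCER TOOL (refinement node of `TreeF`).

THE TRICK. `(B, 𝒜, σ)` a tame node at `p`, `u` a UNIT of degree `0` with `∏_{i<p} σ^i u = 1` (e.g. `σ g = g u` for a non-zero-divisor `g`, `σ^p = 1`: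
`prod_range_iterate_eq_one_of_semiInvariant`). On `B″ := B[T;T⁻¹]`, graded by `ℤ × ι` (`laurentPiece`, part 1), the ring automorphism `σ″ := sigmaLaurent σ u`
(`C b ↦ C (σ b)`, `T ↦ T · C u`; `LaurentPolynomial.eval₂`) is graded of order `p`, and `(B″, laurentPiece 𝒜, σ″)` is a TAME NODE (`isTameNode_laurent`:
Noetherian/regular as the localisation `B[X][X⁻¹]`; (T1) with the extra unit `T` of degree `(1, 0)`; (T2) with `t ∪ {T, T⁻¹}`). If moreover
`augmentationIdeal σ ≤ (β)` and `u - 1 = β ρ` with `ρ` a unit, then `augmentationIdeal σ″ = (C β)` is PRINCIPAL (`augmentationIdeal_sigmaLaurent_eq_span`):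
the multiplicative point is KILLED in the Laurent chart.

* `unitT`, `val_unitT_zpow`, `twistUnit`, `val_twistUnit_zpow`, `sigmaLaurentHom` (+ `_C`, `_T`, `_C_mul_T`), `ringHom_ext_C_T`, `sigmaLaurentHom_comp_eq_id`,
  ★ `sigmaLaurent` (+ `_apply`, `_C`, `_T`, `_C_mul_T`), `sigmaLaurentHom_iterate_C/T`, `isUnit_of_cocycle`, `sigmaLaurent_iterate_eq_self` (order `p`),
  `prod_range_iterate_eq_one_of_semiInvariant`, `sub_one_dvd_val_zpow_sub_one`;
* ★★ `augmentationIdeal_sigmaLaurent_eq_span`; `sigmaLaurent_mem` (graded); ★★ `isTameNode_laurent`; ★★ `exists_laurentKilledNode` (the SIG's `LaurentKilledNode p`,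
  discharged for `p > 0`; homogeneity of `g` is not needed).
-/

set_option linter.dupNamespace false

noncomputable section

open DirectSum Literature.AlgebraicGeometry.Resolution
open scoped LaurentPolynomial
open Summit.ResolutionOfSingularities.ResolutionOfSingularities.Theorems.WildQuotientResolution.S1
open Summit.ResolutionOfSingularities.ResolutionOfSingularities.Theorems.WildQuotientResolution.S1.ReesBigrading
open Summit.ResolutionOfSingularities.ResolutionOfSingularities.Theorems.WildQuotientResolution.S1.ProducerStep

namespace Summit.ResolutionOfSingularities.ResolutionOfSingularities.Theorems.WildQuotientResolution.S1.MultGood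

universe u v

/-! ## The twisted extension `σ″` of `σ` to `B[T;T⁻¹]`: `C b ↦ C (σ b)`, `T ↦ T · C u` -/

section Twist

variable {B : Type u} [CommRing B]

/-- The unit `T` of `B[T;T⁻¹]`. -/
def unitT : (B[T;T⁻¹])ˣ := unitOfInvertible (LaurentPolynomial.T 1)

/-- `unitT = T 1`. -/
@[simp] theorem val_unitT : ((unitT : (B[T;T⁻¹])ˣ) : B[T;T⁻¹]) = LaurentPolynomial.T 1 := rfl

/-- `unitT ^ n = T n`. -/
theorem val_unitT_zpow (n : ℤ) : ((unitT ^ n : (B[T;T⁻¹])ˣ) : B[T;T⁻¹]) = LaurentPolynomial.T n := by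
  cases n with
  | ofNat k =>
    rw [Int.ofNat_eq_natCast, zpow_natCast, Units.val_pow_eq_pow_val, val_unitT, LaurentPolynomial.T_pow, mul_one]
  | negSucc k =>
    rw [zpow_negSucc]
    apply Units.inv_eq_of_mul_eq_one_right
    have h0 : ((k + 1 : ℕ) : ℤ) + Int.negSucc k = 0 := by rw [Int.negSucc_eq]; push_cast; ring
    rw [Units.val_pow_eq_pow_val, val_unitT, LaurentPolynomial.T_pow, mul_one, ← LaurentPolynomial.T_add, h0, LaurentPolynomial.T_zero]

/-- The twisting unit `T · C u`. -/
def twistUnit (u : Bˣ) : (B[T;T⁻¹])ˣ := unitT * Units.map (LaurentPolynomial.C : B →+* B[T;T⁻¹]).toMonoidHom u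

/-- `twistUnit u = T · C u`. -/
@[simp] theorem val_twistUnit (u : Bˣ) : ((twistUnit u : (B[T;T⁻¹])ˣ) : B[T;T⁻¹]) = LaurentPolynomial.T 1 * LaurentPolynomial.C (u : B) := rfl

/-- `(twistUnit u) ^ n = Tⁿ · C (uⁿ)`. -/
theorem val_twistUnit_zpow (u : Bˣ) (n : ℤ) :
    ((twistUnit u ^ n : (B[T;T⁻¹])ˣ) : B[T;T⁻¹]) = LaurentPolynomial.T n * LaurentPolynomial.C ((u ^ n : Bˣ) : B) := by
  rw [twistUnit, mul_zpow, Units.val_mul, val_unitT_zpow, ← map_zpow]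
  rfl

/-- The ring endomorphism `σ″` of `B[T;T⁻¹]`: `C b ↦ C (σ b)`, `T ↦ T · C u`. -/
def sigmaLaurentHom (σ : B →+* B) (u : Bˣ) : B[T;T⁻¹] →+* B[T;T⁻¹] :=
  LaurentPolynomial.eval₂ ((LaurentPolynomial.C : B →+* B[T;T⁻¹]).comp σ) (twistUnit u)

/-- `σ″ (C b) = C (σ b)`. -/
@[simp] theorem sigmaLaurentHom_C (σ : B →+* B) (u : Bˣ) (b : B) :
    sigmaLaurentHom σ u (LaurentPolynomial.C b) = LaurentPolynomial.C (σ b) := by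
  rw [sigmaLaurentHom, LaurentPolynomial.eval₂_C, RingHom.comp_apply]

/-- `σ″ (T n) = Tⁿ · C (uⁿ)`. -/
@[simp] theorem sigmaLaurentHom_T (σ : B →+* B) (u : Bˣ) (n : ℤ) :
    sigmaLaurentHom σ u (LaurentPolynomial.T n) = LaurentPolynomial.T n * LaurentPolynomial.C ((u ^ n : Bˣ) : B) := by
  rw [sigmaLaurentHom, LaurentPolynomial.eval₂_T, val_twistUnit_zpow]

/-- `σ″ (C b · Tⁿ) = C (σ b · uⁿ) · Tⁿ`. -/
theorem sigmaLaurentHom_C_mul_T (σ : B →+* B) (u : Bˣ) (b : B) (n : ℤ) :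
    sigmaLaurentHom σ u (LaurentPolynomial.C b * LaurentPolynomial.T n) =
      LaurentPolynomial.C (σ b * ((u ^ n : Bˣ) : B)) * LaurentPolynomial.T n := by
  rw [map_mul, sigmaLaurentHom_C, sigmaLaurentHom_T, map_mul]
  ring

/-- Ring homomorphisms out of `B[T;T⁻¹]` agreeing on `C b` and on `T` are equal (`B[T;T⁻¹]` is `B[X][X⁻¹]`). -/
theorem ringHom_ext_C_T {S : Type*} [CommRing S] {f g : B[T;T⁻¹] →+* S} (hC : ∀ b : B, f (LaurentPolynomial.C b) = g (LaurentPolynomial.C b))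
    (hT : f (LaurentPolynomial.T 1) = g (LaurentPolynomial.T 1)) : f = g := by
  refine IsLocalization.ringHom_ext (Submonoid.powers (Polynomial.X : Polynomial B)) ?_
  refine Polynomial.ringHom_ext (fun b => ?_) ?_
  · rw [RingHom.comp_apply, RingHom.comp_apply, LaurentPolynomial.algebraMap_eq_toLaurent, Polynomial.toLaurent_C]
    exact hC b
  · rw [RingHom.comp_apply, RingHom.comp_apply, LaurentPolynomial.algebraMap_eq_toLaurent, Polynomial.toLaurent_X]
    exact hT

/-- Two twisted extensions compose to the identity when `σ′ ∘ σ = id` and `σ′(u) · u′ = 1`. -/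
theorem sigmaLaurentHom_comp_eq_id (σ σ' : B →+* B) (u u' : Bˣ) (hσ : ∀ b, σ' (σ b) = b) (hu : σ' (u : B) * (u' : B) = 1) :
    (sigmaLaurentHom σ' u').comp (sigmaLaurentHom σ u) = RingHom.id _ := by
  refine ringHom_ext_C_T (fun b => ?_) ?_
  · rw [RingHom.comp_apply, sigmaLaurentHom_C, sigmaLaurentHom_C, RingHom.id_apply, hσ]
  · rw [RingHom.comp_apply, sigmaLaurentHom_T, zpow_one, map_mul, sigmaLaurentHom_T, zpow_one, sigmaLaurentHom_C, RingHom.id_apply,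
      mul_assoc, ← map_mul, mul_comm (u' : B), hu, map_one, mul_one]

/-- ★ **The twisted extension `σ″ = sigmaLaurent σ u` as a ring AUTOMORPHISM of `B[T;T⁻¹]`** (inverse: the twisted extension of `σ⁻¹` by
`(σ⁻¹ u)⁻¹`). [OURS · L1 W4.5c · (M)] -/
def sigmaLaurent (σ : B ≃+* B) (u : Bˣ) : B[T;T⁻¹] ≃+* B[T;T⁻¹] :=
  RingEquiv.ofRingHom (sigmaLaurentHom (σ : B →+* B) u)
    (sigmaLaurentHom ((σ.symm : B ≃+* B) : B →+* B) (Units.map ((σ.symm : B ≃+* B) : B →+* B).toMonoidHom u)⁻¹)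
    (sigmaLaurentHom_comp_eq_id _ _ _ _ (fun b => σ.apply_symm_apply b) (by
      rw [Units.coe_map_inv]
      change σ (σ.symm (↑u⁻¹ : B)) * ↑u = 1
      rw [σ.apply_symm_apply, Units.inv_mul]))
    (sigmaLaurentHom_comp_eq_id _ _ _ _ (fun b => σ.symm_apply_apply b) (by
      rw [Units.coe_map_inv]
      change σ.symm (u : B) * σ.symm (↑u⁻¹ : B) = 1
      rw [← map_mul, Units.mul_inv, map_one]))

/-- Pin: `σ″` is the twisted extension hom. -/
theorem sigmaLaurent_apply (σ : B ≃+* B) (u : Bˣ) (q : B[T;T⁻¹]) : sigmaLaurent σ u q = sigmaLaurentHom (σ : B →+* B) u q := rfl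

/-- `σ″ (C b) = C (σ b)`. -/
@[simp] theorem sigmaLaurent_C (σ : B ≃+* B) (u : Bˣ) (b : B) : sigmaLaurent σ u (LaurentPolynomial.C b) = LaurentPolynomial.C (σ b) :=
  sigmaLaurentHom_C _ _ _

/-- `σ″ (T n) = Tⁿ · C (uⁿ)`; in particular `σ″ T = T · C u`. -/
@[simp] theorem sigmaLaurent_T (σ : B ≃+* B) (u : Bˣ) (n : ℤ) :
    sigmaLaurent σ u (LaurentPolynomial.T n) = LaurentPolynomial.T n * LaurentPolynomial.C ((u ^ n : Bˣ) : B) :=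
  sigmaLaurentHom_T _ _ _

/-- `σ″ (C b · Tⁿ) = C (σ b · uⁿ) · Tⁿ`. -/
theorem sigmaLaurent_C_mul_T (σ : B ≃+* B) (u : Bˣ) (b : B) (n : ℤ) :
    sigmaLaurent σ u (LaurentPolynomial.C b * LaurentPolynomial.T n) = LaurentPolynomial.C (σ b * ((u ^ n : Bˣ) : B)) * LaurentPolynomial.T n :=
  sigmaLaurentHom_C_mul_T _ _ _ _

/-! ### Iterates and the order of `σ″` -/

/-- `σ″^k (C b) = C (σ^k b)`. -/
theorem sigmaLaurentHom_iterate_C (σ : B →+* B) (u : Bˣ) (k : ℕ) (b : B) :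
    (sigmaLaurentHom σ u)^[k] (LaurentPolynomial.C b) = LaurentPolynomial.C (σ^[k] b) := by
  induction k with
  | zero => rfl
  | succ k ih => rw [Function.iterate_succ_apply', ih, sigmaLaurentHom_C, Function.iterate_succ_apply']

/-- `σ″^k T = T · C (∏_{i<k} σ^i u)`. -/
theorem sigmaLaurentHom_iterate_T (σ : B →+* B) (u : Bˣ) (k : ℕ) :
    (sigmaLaurentHom σ u)^[k] (LaurentPolynomial.T 1) = LaurentPolynomial.T 1 * LaurentPolynomial.C (∏ i ∈ Finset.range k, σ^[i] (u : B)) := by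
  induction k with
  | zero => rw [Function.iterate_zero, id, Finset.prod_range_zero, map_one, mul_one]
  | succ k ih =>
    rw [Function.iterate_succ_apply', ih, map_mul, sigmaLaurentHom_T, zpow_one, sigmaLaurentHom_C, map_prod, Finset.prod_range_succ',
      Function.iterate_zero, id, mul_assoc, ← map_mul]
    congr 2
    rw [mul_comm]
    congr 1
    exact Finset.prod_congr rfl fun i _ => (Function.iterate_succ_apply' σ i (u : B)).symm

/-- A `σ`-COCYCLE unit: `∏_{i<p} σ^i u = 1` with `0 < p` makes `u` a unit. -/
theorem isUnit_of_cocycle (σ : B →+* B) {p : ℕ} (hp : 0 < p) (u : B) (hnorm : ∏ i ∈ Finset.range p, σ^[i] u = 1) : IsUnit u := by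
  obtain ⟨k, rfl⟩ := Nat.exists_eq_add_of_le' hp
  rw [Finset.prod_range_succ', Function.iterate_zero, id, mul_comm] at hnorm
  exact IsUnit.of_mul_eq_one _ hnorm

/-- ★ **`σ″` has order dividing `p`** when `σ` has and `u` is a `σ`-cocycle (`∏_{i<p} σ^i u = 1`). [OURS · L1 W4.5c · (M)] -/
theorem sigmaLaurent_iterate_eq_self (σ : B ≃+* B) (u : Bˣ) {p : ℕ} (hσp : ∀ b : B, (⇑σ)^[p] b = b)
    (hnorm : ∏ i ∈ Finset.range p, (⇑σ)^[i] (u : B) = 1) (q : B[T;T⁻¹]) : (⇑(sigmaLaurent σ u))^[p] q = q := by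
  have key : (sigmaLaurentHom (σ : B →+* B) u) ^ p = RingHom.id _ := by
    refine ringHom_ext_C_T (fun b => ?_) ?_
    · rw [RingHom.coe_pow, sigmaLaurentHom_iterate_C, RingHom.id_apply]
      exact congrArg LaurentPolynomial.C (hσp b)
    · rw [RingHom.coe_pow, sigmaLaurentHom_iterate_T, RingHom.id_apply]
      have : ∏ i ∈ Finset.range p, (⇑(σ : B →+* B))^[i] (u : B) = 1 := hnorm
      rw [this, map_one, mul_one]
  have hcoe : ⇑(sigmaLaurent σ u) = ⇑(sigmaLaurentHom (σ : B →+* B) u) := rfl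
  rw [hcoe, ← RingHom.coe_pow, key, RingHom.coe_id, id]

/-- The `σ`-cocycle of a SEMI-INVARIANT non-zero-divisor: `σ g = g u`, `σ^p = 1` ⇒ `∏_{i<p} σ^i u = 1`. -/
theorem prod_range_iterate_eq_one_of_semiInvariant (σ : B ≃+* B) {p : ℕ} (hσp : ∀ b : B, (⇑σ)^[p] b = b) (g : B) (hg : g ∈ nonZeroDivisors B)
    (u : B) (hgu : σ g = g * u) : ∏ i ∈ Finset.range p, (⇑σ)^[i] u = 1 := by
  have key : ∀ k : ℕ, (⇑σ)^[k] g = g * ∏ i ∈ Finset.range k, (⇑σ)^[i] u := by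
    intro k
    induction k with
    | zero => rw [Function.iterate_zero, id, Finset.prod_range_zero, mul_one]
    | succ k ih =>
      rw [Function.iterate_succ_apply', ih, map_mul, hgu, map_prod, Finset.prod_range_succ', Function.iterate_zero, id, mul_assoc]
      congr 1
      rw [mul_comm]
      congr 1
      exact Finset.prod_congr rfl fun i _ => (Function.iterate_succ_apply' σ i u).symm
  have h := key p
  rw [hσp g] at h
  have h2 : g * (∏ i ∈ Finset.range p, (⇑σ)^[i] u - 1) = 0 := by rw [mul_sub, mul_one, ← h, sub_self]
  exact sub_eq_zero.mp ((mem_nonZeroDivisors_iff.mp hg).1 _ h2)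

/-- `u - 1 ∣ uⁿ - 1` for every integer `n`. -/
theorem sub_one_dvd_val_zpow_sub_one (u : Bˣ) (n : ℤ) : (u : B) - 1 ∣ ((u ^ n : Bˣ) : B) - 1 := by
  have hnat : ∀ k : ℕ, (u : B) - 1 ∣ (u : B) ^ k - 1 := fun k => by simpa using sub_dvd_pow_sub_pow (u : B) 1 k
  cases n with
  | ofNat k => rw [Int.ofNat_eq_natCast, zpow_natCast, Units.val_pow_eq_pow_val]; exact hnat k
  | negSucc k =>
    rw [zpow_negSucc, ← inv_pow, Units.val_pow_eq_pow_val]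
    have hp : (↑u⁻¹ : B) ^ (k + 1) * (u : B) ^ (k + 1) = 1 := by rw [← mul_pow, Units.inv_mul, one_pow]
    have h2 : (↑u⁻¹ : B) ^ (k + 1) - 1 = -(↑u⁻¹ : B) ^ (k + 1) * ((u : B) ^ (k + 1) - 1) := by linear_combination hp
    rw [h2]
    exact (hnat (k + 1)).mul_left _

/-! ### The augmentation ideal of `σ″` -/

/-- ★★ **The multiplicative point is KILLED in the Laurent node**: if `augmentationIdeal σ ≤ (β)` and `u - 1 = β ρ` with `ρ` a unit, then
`augmentationIdeal σ″ = (C β)` is PRINCIPAL. [OURS · L1 W4.5c · (M), A-NIL v0 §3] -/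
theorem augmentationIdeal_sigmaLaurent_eq_span (σ : B ≃+* B) (u : Bˣ) (β ρ : B) (haug : augmentationIdeal σ ≤ Ideal.span {β})
    (hu : (u : B) - 1 = β * ρ) (hρ : IsUnit ρ) :
    augmentationIdeal (sigmaLaurent σ u) = Ideal.span {LaurentPolynomial.C β} := by
  apply le_antisymm
  · rw [augmentationIdeal, Ideal.span_le]
    rintro _ ⟨q, rfl⟩
    rw [SetLike.mem_coe]
    change sigmaLaurent σ u q - q ∈ _
    induction q using LaurentPolynomial.induction_on' with
    | add q q' hq hq' => rw [map_add, add_sub_add_comm]; exact add_mem hq hq'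
    | C_mul_T n a =>
      rw [sigmaLaurent_C_mul_T, ← sub_mul, ← map_sub]
      refine Ideal.mul_mem_right _ _ ?_
      have hdec : σ a * ((u ^ n : Bˣ) : B) - a = (σ a - a) * ((u ^ n : Bˣ) : B) + a * (((u ^ n : Bˣ) : B) - 1) := by ring
      rw [hdec, map_add, map_mul, map_mul]
      refine add_mem (Ideal.mul_mem_right _ _ ?_) (Ideal.mul_mem_left _ _ ?_)
      · have h1 : σ a - a ∈ Ideal.span {β} := haug (Ideal.subset_span ⟨a, rfl⟩)
        obtain ⟨c, hc⟩ := Ideal.mem_span_singleton'.mp h1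
        rw [← hc, map_mul]
        exact Ideal.mul_mem_left _ _ (Ideal.subset_span rfl)
      · obtain ⟨c, hc⟩ := sub_one_dvd_val_zpow_sub_one u n
        rw [hc, hu, map_mul, map_mul, mul_assoc]
        exact Ideal.mul_mem_right _ _ (Ideal.subset_span rfl)
  · rw [Ideal.span_le, Set.singleton_subset_iff, SetLike.mem_coe]
    obtain ⟨ρu, hρu⟩ := hρ
    have hmem : sigmaLaurent σ u (LaurentPolynomial.T 1) - LaurentPolynomial.T 1 ∈ augmentationIdeal (sigmaLaurent σ u) :=
      Ideal.subset_span ⟨_, rfl⟩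
    have hTT : LaurentPolynomial.T 1 * LaurentPolynomial.T (-1) = (1 : B[T;T⁻¹]) := by
      rw [← LaurentPolynomial.T_add, add_neg_cancel, LaurentPolynomial.T_zero]
    have hcalc : LaurentPolynomial.C β = (sigmaLaurent σ u (LaurentPolynomial.T 1) - LaurentPolynomial.T 1) *
        (LaurentPolynomial.T (-1) * LaurentPolynomial.C (↑ρu⁻¹ : B)) := by
      rw [sigmaLaurent_T, zpow_one, show LaurentPolynomial.T 1 * LaurentPolynomial.C (u : B) - LaurentPolynomial.T 1 =
        LaurentPolynomial.T 1 * LaurentPolynomial.C ((u : B) - 1) by rw [map_sub, map_one, mul_sub, mul_one], hu, ← hρu]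
      calc LaurentPolynomial.C β = LaurentPolynomial.C β * (LaurentPolynomial.T 1 * LaurentPolynomial.T (-1)) *
            LaurentPolynomial.C ((ρu : B) * ↑ρu⁻¹) := by rw [hTT, Units.mul_inv, map_one, mul_one, mul_one]
        _ = _ := by rw [map_mul, map_mul]; ring
    rw [hcalc]
    exact Ideal.mul_mem_right _ _ hmem

end Twist

/-! ## `σ″` is graded; the Laurent node is a TAME NODE -/

section Tame

variable {ι : Type v} [AddCommGroup ι] [DecidableEq ι] {B : Type u} [CommRing B] (𝒜 : ι → AddSubgroup B) [GradedRing 𝒜]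

/-- `σ″` preserves the bidegrees (for `σ` graded and `u` of degree `0`). -/
theorem sigmaLaurent_mem (σ : B ≃+* B) (hσ : ∀ i : ι, ∀ b ∈ 𝒜 i, σ b ∈ 𝒜 i) (u : Bˣ) (hu : (u : B) ∈ 𝒜 0) (ni : ℤ × ι) (q : B[T;T⁻¹])
    (hq : q ∈ laurentPiece 𝒜 ni) : sigmaLaurent σ u q ∈ laurentPiece 𝒜 ni := by
  obtain ⟨x, hx, rfl⟩ := hq
  refine ⟨σ x * ((u ^ ni.1 : Bˣ) : B), ?_, sigmaLaurent_C_mul_T _ _ _ _⟩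
  have := SetLike.mul_mem_graded (hσ _ x hx) (val_zpow_mem_zero 𝒜 u hu ni.1)
  rwa [add_zero] at this

end Tame

/-- ★★ **THE LAURENT NODE IS A TAME NODE.** For a tame node `(B, 𝒜, σ)` at `p` and a degree-`0` unit `u` with `∏_{i<p} σ^i u = 1`:
`(B[T;T⁻¹], laurentPiece 𝒜, sigmaLaurent σ u)` is a tame node at `p` (Noetherian and regular as the localisation `B[X][X⁻¹]`; (T1) with the extra unit
`T` of degree `(1,0)`; (T2) with `t ∪ {T, T⁻¹}`; graded; order `p`). [OURS · L1 W4.5c · (M)] -/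
theorem isTameNode_laurent {ι : Type v} [AddCommGroup ι] [DecidableEq ι] {B : Type} [CommRing B] (𝒜 : ι → AddSubgroup B) [GradedRing 𝒜]
    (σ : B ≃+* B) {p : ℕ} (h : IsTameNode p B 𝒜 σ) (u : Bˣ) (hu : (u : B) ∈ 𝒜 0) (hnorm : ∏ i ∈ Finset.range p, (⇑σ)^[i] (u : B) = 1) :
    letI := laurentGradedRing 𝒜
    IsTameNode p B[T;T⁻¹] (laurentPiece 𝒜) (sigmaLaurent σ u) := by
  classical
  letI := laurentGradedRing 𝒜
  obtain ⟨hN, hR, ⟨s, hs, hfi⟩, ⟨t, ht⟩, hσ, hσp⟩ := h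
  refine ⟨?_, ?_, ⟨insert ((1 : ℤ), (0 : ι)) (s.image fun d => ((0 : ℤ), d)), ?_, ?_⟩, ?_, ?_, sigmaLaurent_iterate_eq_self σ u hσp hnorm⟩
  · exact IsLocalization.isNoetherianRing (Submonoid.powers (Polynomial.X : Polynomial B)) B[T;T⁻¹] inferInstance
  · exact FRationalResolution.toricDegenerate_laurentPolynomial_isRegularRing B
  · intro d hd
    rw [Finset.mem_insert, Finset.mem_image] at hd
    rcases hd with rfl | ⟨d₀, hd₀, rfl⟩
    · exact ⟨LaurentPolynomial.T 1, LaurentPolynomial.isUnit_T 1, T_mem_laurentPiece 𝒜 1⟩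
    · obtain ⟨v, hv, hvd⟩ := hs d₀ hd₀
      exact ⟨LaurentPolynomial.C v, hv.map _, C_mem_laurentPiece 𝒜 hvd⟩
  · -- finite index: the closure contains `ℤ × closure s`
    have hle : (⊤ : AddSubgroup ℤ).prod (AddSubgroup.closure (s : Set ι)) ≤
        AddSubgroup.closure ((insert ((1 : ℤ), (0 : ι)) (s.image fun d => ((0 : ℤ), d)) : Finset (ℤ × ι)) : Set (ℤ × ι)) := by
      rintro ⟨n, i⟩ ⟨-, hi⟩
      have h1 : ((n, i) : ℤ × ι) = n • ((1 : ℤ), (0 : ι)) + AddMonoidHom.inr ℤ ι i := by ext <;> simp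
      rw [h1]
      refine add_mem (AddSubgroup.zsmul_mem _ (AddSubgroup.subset_closure (by simp)) n) ?_
      have h2 : (AddSubgroup.closure (s : Set ι)).map (AddMonoidHom.inr ℤ ι) ≤
          AddSubgroup.closure ((insert ((1 : ℤ), (0 : ι)) (s.image fun d => ((0 : ℤ), d)) : Finset (ℤ × ι)) : Set (ℤ × ι)) := by
        rw [AddMonoidHom.map_closure]
        refine AddSubgroup.closure_mono ?_
        rintro _ ⟨d, hd, rfl⟩
        rw [Finset.coe_insert, Finset.coe_image]
        exact Or.inr ⟨d, hd, rfl⟩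
      exact h2 ⟨i, (hi : i ∈ AddSubgroup.closure (s : Set ι)), rfl⟩
    haveI : ((⊤ : AddSubgroup ℤ).prod (AddSubgroup.closure (s : Set ι))).FiniteIndex := by
      rw [AddSubgroup.finiteIndex_iff, AddSubgroup.index_prod, AddSubgroup.index_top, one_mul]
      exact AddSubgroup.finiteIndex_iff.mp hfi
    exact AddSubgroup.finiteIndex_of_le hle
  · -- (T2): generated by `C (𝒜 0)`, `C t`, `T`, `T⁻¹`
    refine ⟨insert (LaurentPolynomial.T 1) (insert (LaurentPolynomial.T (-1)) (t.image (LaurentPolynomial.C : B →+* B[T;T⁻¹]))), ?_⟩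
    set S : Subring B[T;T⁻¹] := Subring.closure (((laurentPiece 𝒜 0 : AddSubgroup B[T;T⁻¹]) : Set B[T;T⁻¹]) ∪
      ↑(insert (LaurentPolynomial.T 1) (insert (LaurentPolynomial.T (-1)) (t.image (LaurentPolynomial.C : B →+* B[T;T⁻¹]))))) with hS
    have hC : ∀ b : B, LaurentPolynomial.C b ∈ S := by
      intro b
      have hb : b ∈ Subring.closure (((𝒜 0 : AddSubgroup B) : Set B) ∪ ↑t) := by rw [ht]; trivial
      have hmap : (Subring.closure (((𝒜 0 : AddSubgroup B) : Set B) ∪ ↑t)).map (LaurentPolynomial.C : B →+* B[T;T⁻¹]) ≤ S := by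
        rw [RingHom.map_closure]
        refine Subring.closure_mono ?_
        rintro _ ⟨x, hx | hx, rfl⟩
        · exact Or.inl (C_mem_laurentPiece 𝒜 hx)
        · refine Or.inr ?_
          rw [Finset.coe_insert, Finset.coe_insert, Finset.coe_image]
          exact Or.inr (Or.inr ⟨x, hx, rfl⟩)
      exact hmap ⟨b, hb, rfl⟩
    have hT1 : LaurentPolynomial.T 1 ∈ S := Subring.subset_closure (Or.inr (by simp))
    have hT1' : LaurentPolynomial.T (-1) ∈ S := Subring.subset_closure (Or.inr (by simp))
    have hT : ∀ n : ℤ, LaurentPolynomial.T n ∈ S := by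
      intro n
      cases n with
      | ofNat k =>
        have : LaurentPolynomial.T (k : ℤ) = (LaurentPolynomial.T 1 : B[T;T⁻¹]) ^ k := by rw [LaurentPolynomial.T_pow, mul_one]
        rw [Int.ofNat_eq_natCast, this]
        exact pow_mem hT1 k
      | negSucc k =>
        have : LaurentPolynomial.T (Int.negSucc k) = (LaurentPolynomial.T (-1) : B[T;T⁻¹]) ^ (k + 1) := by
          rw [LaurentPolynomial.T_pow, Int.negSucc_eq]; push_cast; ring_nf
        rw [this]
        exact pow_mem hT1' (k + 1)
    rw [eq_top_iff]
    rintro q -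
    induction q using LaurentPolynomial.induction_on' with
    | add q q' hq hq' => exact add_mem hq hq'
    | C_mul_T n a => exact mul_mem (hC a) (hT n)
  · intro ni q hq
    exact sigmaLaurent_mem 𝒜 σ hσ u hu ni q hq

/-! ## The SIG `LaurentKilledNode p`, discharged -/

/-- ★★ **`LaurentKilledNode` (SIG (M) v2), DISCHARGED** — for a tame node `(B, 𝒜, σ)` at `p > 0` (`Π ZMod`-graded), `augmentationIdeal σ ≤ (β)`, a
non-zero-divisor `g` with `σ g = g u`, `u` of degree `0`, `u - 1 = β ρ`, `ρ` a unit: the Laurent node `(B[T;T⁻¹], 𝒜″, σ″)` with `C b · Tⁿ ∈ 𝒜″ (n, deg b)`,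
`σ″ (C b) = C (σ b)`, `σ″ T = T · C u` is a tame node at `p` with `augmentationIdeal σ″ = (C β)`. (Homogeneity of `g` is not needed: only the cocycle
`∏_{i<p} σ^i u = 1` it produces.) [OURS · L1 W4.5c · (M)] -/
theorem exists_laurentKilledNode {B : Type} [CommRing B] {m : ℕ} (r : Fin m → ℕ) (𝒜 : (Π j : Fin m, ZMod (r j)) → AddSubgroup B) [GradedRing 𝒜]
    (σ : B ≃+* B) {p : ℕ} (hp : 0 < p) (hnode : IsTameNode p B 𝒜 σ) (β g u ρ : B) (haug : augmentationIdeal σ ≤ Ideal.span {β})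
    (hg : g ∈ nonZeroDivisors B) (hu0 : u ∈ 𝒜 0) (hgu : σ g = g * u) (hu : u - 1 = β * ρ) (hρ : IsUnit ρ) :
    ∃ (𝒜'' : (ℤ × (Π j : Fin m, ZMod (r j))) → AddSubgroup (LaurentPolynomial B)) (_ : GradedRing 𝒜'')
      (σ'' : LaurentPolynomial B ≃+* LaurentPolynomial B),
      IsTameNode p (LaurentPolynomial B) 𝒜'' σ'' ∧
      (∀ (n : ℤ) (e : Π j : Fin m, ZMod (r j)) (b : B), b ∈ 𝒜 e → LaurentPolynomial.C b * LaurentPolynomial.T n ∈ 𝒜'' (n, e)) ∧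
      (∀ b : B, σ'' (LaurentPolynomial.C b) = LaurentPolynomial.C (σ b)) ∧
      σ'' (LaurentPolynomial.T 1) = LaurentPolynomial.T 1 * LaurentPolynomial.C u ∧
      augmentationIdeal σ'' = Ideal.span {LaurentPolynomial.C β} := by
  have hnorm := prod_range_iterate_eq_one_of_semiInvariant σ hnode.2.2.2.2.2 g hg u hgu
  obtain ⟨uu, rfl⟩ := isUnit_of_cocycle (σ : B →+* B) hp u hnorm
  exact ⟨laurentPiece 𝒜, laurentGradedRing 𝒜, sigmaLaurent σ uu, isTameNode_laurent 𝒜 σ hnode uu hu0 hnorm,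
    fun n e b hb => C_mul_T_mem_laurentPiece 𝒜 hb n, fun b => sigmaLaurent_C σ uu b, by rw [sigmaLaurent_T, zpow_one],
    augmentationIdeal_sigmaLaurent_eq_span σ uu β ρ haug hu hρ⟩


end Summit.ResolutionOfSingularities.ResolutionOfSingularities.Theorems.WildQuotientResolution.S1.MultGood

end
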